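import Summits.HodgeConjecture.CorCM.Census.CentralSquaresNearLatticePow

/-!
# The square-central class, XLII: residual closure up to `2m` from the FIBRE CONGRUENCES of the cyclic-kernel rows

COR-CM (cell `pub-hodgecm2`), count-neutral kernel combinatorics by the binder seat b09 (gen 48; lane SQUARE-CENTRAL CLASS, part XLII), on part XXIV
(`residual_closure_four_pow`) BY NAME.  Theorems only: no definition, no `decide`, no certificate, no named fact, no `sorry`.  HONEST FRAMING: `HC_CM` is
NOT proved, here or anywhere in the tree; nothing here is a period or a headline.

THE CYCLIC-KERNEL ROWS (`π : G ↠ D₄` with `ker π = ⟨g₁²⟩` for a lift `g₁` of the reflection `sr`; design note `CYCLIC-KERNEL.md`, gen 48).  Frame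
`(T₀; T₁)` with `𝓗 = T₀ ∖ T₁ = T ⊔ T'` and `𝓗ᶜ = T₀ ∩ T₁ = A ⊔ A'` split into the four fibres (`T = π⁻¹(r)`, `T' = π⁻¹(sr)`, `A = π⁻¹(s)`,
`A' = π⁻¹(1)`, each of size `m = |ker π|`).  Part XLIʼs one new relation `Y_h − Y'_{h·g₁⁻¹}` (`h ∈ T'`) and its `G`-translates link the fibres pairwise:
the `ker π`- and `π⁻¹(sr)`-translates are two perfect matchings `T' ↔ A'` whose union is a single cycle exactly when `g₁²` generates the kernel, so
ALL `Y_x` (`x ∈ T'`) and all `Y'_y` (`y ∈ A'`) are congruent to one class `U` modulo `L`; the `s`- and `r`-translates likewise make all `Y_x` (`x ∈ T`)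
congruent to a class `V` and all `Y'_y` (`y ∈ A`) to `−V`.  This file is the bookkeeping AFTER the congruences (which the frame law of part XLIII derives):

* §1 `rel_sub_rel_compl`, `relc_sub_relc_compl`: `R(T) − R(𝓗 ∖ T) = Σ_T Y − Σ_{𝓗∖T} Y` and `Rᶜ(A) − Rᶜ(𝓗ᶜ ∖ A) = Σ_A Y' − Σ_{𝓗ᶜ∖A} Y'`
  (`|T| = |A| = m`; exact identities, the base-type terms cancel).
* §2 `two_mul_smul_mem_of_congruences` (any `ℤ`-module): the two differences of sums and the four families of congruences give `m(V − U) ∈ L`,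
  `m(V + U) ∈ L`, hence `2m·U, 2m·V ∈ L` and `2m·Y_x`, `2m·Y'_y` for every place.
* §3 **`residual_closure_cyclic`**: with `2m = 2ᵏ`, pairs, `R(T)`, `R(T')`, `Rᶜ(A)`, `Rᶜ(A')` in `L` and the congruences, every residual Hodge vector `y`
  has `2ᵏ·y ∈ L` (part XXIV `residual_closure_four_pow`).  For `m = 2` this is part XXXʼs closure up to `4`; for `m = 4` (order `32`, the rows
  `ℤ/4 ⋊ ℤ/8`) the closure is up to `8`, quotient `ℤ/4 × ℤ/8` numerically.

Notation: `e₀ = [T₀]`, `e₁ = [T₁]`, `f_s = [T₀^{(s)}]`, `g_s = [T₁^{(s)}]`, `Y_s = (f_s − e₀) + (g_s − e₁)`, `Y'_s = (f_s − e₀) − (g_s − e₁)`,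
`R(T) = Σ_{t ∈ T} f_t − Σ_{u ∈ 𝓗∖T} g_u − (m−1)(e₀ − e₁)`, `Rᶜ(A) = Σ_{t ∈ A} f_t + Σ_{u ∈ 𝓗ᶜ∖A} g_u − (m−1)(e₀ + e₁)`.

## References
* [Pohlmann1968] H. Pohlmann, Algebraic cycles on abelian varieties of complex multiplication type, Ann. of Math. 88 (1968), Thm 1.
-/

namespace Summit.HodgeConjecture.CorCM.Census.CentralSquares

open Finset
open scoped symmDiff
open Summit.HodgeConjecture.CorCM.Prior.AllgGroup.RfwfAllgGroup
open Summit.HodgeConjecture.CorCM.Census.BlockParity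
open Summit.HodgeConjecture.CorCM.Census.Coinvariant
open Summit.HodgeConjecture.CorCM.Census.TwistGeneration
open Summit.HodgeConjecture.CorCM.Census.BaseBlock
open Summit.HodgeConjecture.CorCM.Census.CoverClosure

noncomputable section

variable {G : Type*} [Group G] [Fintype G] [DecidableEq G] (c : G)

/-! ## §1 Differences of complementary transversal relations -/

/-- **`R(T) − R(𝓗 ∖ T) = Σ_{s∈T} Y_s − Σ_{s∈𝓗∖T} Y_s`** for `T ⊆ 𝓗` with `|T| = m`, `|𝓗| = 2m` (the base-type terms cancel). [folklore] -/
theorem rel_sub_rel_compl (hc2 : c * c = 1) (T₀ T₁ : CMF G c) (m : ℕ) (hH : (T₀.1 \ T₁.1).card = 2 * m)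
    (T : Finset G) (hTH : T ⊆ T₀.1 \ T₁.1) (hTm : T.card = m) :
    (∑ s ∈ T, Finsupp.single (oflipCM c hc2 s T₀) (1 : ℤ) - ∑ u ∈ (T₀.1 \ T₁.1) \ T, Finsupp.single (oflipCM c hc2 u T₁) (1 : ℤ) -
        ((m : ℤ) - 1) • (Finsupp.single T₀ (1 : ℤ) - Finsupp.single T₁ 1)) -
      (∑ s ∈ (T₀.1 \ T₁.1) \ T, Finsupp.single (oflipCM c hc2 s T₀) (1 : ℤ) -
        ∑ u ∈ (T₀.1 \ T₁.1) \ ((T₀.1 \ T₁.1) \ T), Finsupp.single (oflipCM c hc2 u T₁) (1 : ℤ) -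
        ((m : ℤ) - 1) • (Finsupp.single T₀ (1 : ℤ) - Finsupp.single T₁ 1)) =
      ∑ s ∈ T, ((Finsupp.single (oflipCM c hc2 s T₀) (1 : ℤ) - Finsupp.single T₀ 1) +
          (Finsupp.single (oflipCM c hc2 s T₁) (1 : ℤ) - Finsupp.single T₁ 1)) -
        ∑ s ∈ (T₀.1 \ T₁.1) \ T, ((Finsupp.single (oflipCM c hc2 s T₀) (1 : ℤ) - Finsupp.single T₀ 1) +
          (Finsupp.single (oflipCM c hc2 s T₁) (1 : ℤ) - Finsupp.single T₁ 1)) := by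
  have hTT : (T₀.1 \ T₁.1) \ ((T₀.1 \ T₁.1) \ T) = T := Finset.sdiff_sdiff_eq_self hTH
  have hcT' : ((T₀.1 \ T₁.1) \ T).card = m := by rw [card_sdiff_of_subset hTH, hH, hTm]; omega
  rw [hTT]
  simp only [sum_add_distrib, sum_sub_distrib, sum_const, hTm, hcT', ← Nat.cast_smul_eq_nsmul ℤ]
  abel

/-- **`Rᶜ(A) − Rᶜ(𝓗ᶜ ∖ A) = Σ_{s∈A} Y'_s − Σ_{s∈𝓗ᶜ∖A} Y'_s`** for `A ⊆ 𝓗ᶜ = T₀ ∩ T₁` with `|A| = m`, `|𝓗ᶜ| = 2m`. [folklore] -/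
theorem relc_sub_relc_compl (hc2 : c * c = 1) (T₀ T₁ : CMF G c) (m : ℕ) (hHc : (T₀.1 ∩ T₁.1).card = 2 * m)
    (A : Finset G) (hA : A ⊆ T₀.1 ∩ T₁.1) (hAm : A.card = m) :
    (∑ s ∈ A, Finsupp.single (oflipCM c hc2 s T₀) (1 : ℤ) + ∑ u ∈ (T₀.1 ∩ T₁.1) \ A, Finsupp.single (oflipCM c hc2 u T₁) (1 : ℤ) -
        ((m : ℤ) - 1) • (Finsupp.single T₀ (1 : ℤ) + Finsupp.single T₁ 1)) -
      (∑ s ∈ (T₀.1 ∩ T₁.1) \ A, Finsupp.single (oflipCM c hc2 s T₀) (1 : ℤ) +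
        ∑ u ∈ (T₀.1 ∩ T₁.1) \ ((T₀.1 ∩ T₁.1) \ A), Finsupp.single (oflipCM c hc2 u T₁) (1 : ℤ) -
        ((m : ℤ) - 1) • (Finsupp.single T₀ (1 : ℤ) + Finsupp.single T₁ 1)) =
      ∑ s ∈ A, ((Finsupp.single (oflipCM c hc2 s T₀) (1 : ℤ) - Finsupp.single T₀ 1) -
          (Finsupp.single (oflipCM c hc2 s T₁) (1 : ℤ) - Finsupp.single T₁ 1)) -
        ∑ s ∈ (T₀.1 ∩ T₁.1) \ A, ((Finsupp.single (oflipCM c hc2 s T₀) (1 : ℤ) - Finsupp.single T₀ 1) -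
          (Finsupp.single (oflipCM c hc2 s T₁) (1 : ℤ) - Finsupp.single T₁ 1)) := by
  have hAA : (T₀.1 ∩ T₁.1) \ ((T₀.1 ∩ T₁.1) \ A) = A := Finset.sdiff_sdiff_eq_self hA
  have hcA' : ((T₀.1 ∩ T₁.1) \ A).card = m := by rw [card_sdiff_of_subset hA, hHc, hAm]; omega
  rw [hAA]
  simp only [sum_sub_distrib, sum_const, hAm, hcA', ← Nat.cast_smul_eq_nsmul ℤ]
  abel

/-! ## §2 `2m·U, 2m·V ∈ L` from the fibre congruences (any `ℤ`-module) -/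

/-- **`2m·U, 2m·V ∈ L`.**  In a `ℤ`-module: four index sets `T, T', A, A'` of size `m`, vectors `Y_x`, `Y'_y`, classes `U, V` with `Y_x ≡ V` on `T`,
`Y'_y ≡ −V` on `A`, `Y_x ≡ U` on `T'`, `Y'_y ≡ U` on `A'` modulo `L`, and `Σ_T Y − Σ_{T'} Y ∈ L`, `Σ_A Y' − Σ_{A'} Y' ∈ L`.  Then `m(V − U)`,
`m(V + U) ∈ L`… precisely `2m·U ∈ L` and `2m·V ∈ L`. [folklore] -/
theorem two_mul_smul_mem_of_congruences {ι M : Type*} [AddCommGroup M] (L : Submodule ℤ M) (T T' A A' : Finset ι) (Y Y' : ι → M)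
    (U V : M) (m : ℕ) (hTm : T.card = m) (hT'm : T'.card = m) (hAm : A.card = m) (hA'm : A'.card = m)
    (hR : ∑ x ∈ T, Y x - ∑ x ∈ T', Y x ∈ L) (hRc : ∑ y ∈ A, Y' y - ∑ y ∈ A', Y' y ∈ L)
    (hVT : ∀ x ∈ T, Y x - V ∈ L) (hVA : ∀ y ∈ A, Y' y + V ∈ L) (hUT' : ∀ x ∈ T', Y x - U ∈ L) (hUA' : ∀ y ∈ A', Y' y - U ∈ L) :
    (2 * (m : ℤ)) • U ∈ L ∧ (2 * (m : ℤ)) • V ∈ L := by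
  have h1 : ∑ x ∈ T, Y x - (m : ℤ) • V ∈ L := by
    have e : ∑ x ∈ T, Y x - (m : ℤ) • V = ∑ x ∈ T, (Y x - V) := by
      rw [sum_sub_distrib, sum_const, hTm, ← Nat.cast_smul_eq_nsmul ℤ]
    rw [e]; exact Submodule.sum_mem _ fun x hx => hVT x hx
  have h2 : ∑ y ∈ A, Y' y + (m : ℤ) • V ∈ L := by
    have e : ∑ y ∈ A, Y' y + (m : ℤ) • V = ∑ y ∈ A, (Y' y + V) := by
      rw [sum_add_distrib, sum_const, hAm, ← Nat.cast_smul_eq_nsmul ℤ]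
    rw [e]; exact Submodule.sum_mem _ fun y hy => hVA y hy
  have h3 : ∑ x ∈ T', Y x - (m : ℤ) • U ∈ L := by
    have e : ∑ x ∈ T', Y x - (m : ℤ) • U = ∑ x ∈ T', (Y x - U) := by
      rw [sum_sub_distrib, sum_const, hT'm, ← Nat.cast_smul_eq_nsmul ℤ]
    rw [e]; exact Submodule.sum_mem _ fun x hx => hUT' x hx
  have h4 : ∑ y ∈ A', Y' y - (m : ℤ) • U ∈ L := by
    have e : ∑ y ∈ A', Y' y - (m : ℤ) • U = ∑ y ∈ A', (Y' y - U) := by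
      rw [sum_sub_distrib, sum_const, hA'm, ← Nat.cast_smul_eq_nsmul ℤ]
    rw [e]; exact Submodule.sum_mem _ fun y hy => hUA' y hy
  -- `m(V − U) = (Σ_T Y − Σ_{T'} Y) − (Σ_T Y − mV) + (Σ_{T'} Y − mU)`
  have hVU : (m : ℤ) • V - (m : ℤ) • U ∈ L := by
    have e : (m : ℤ) • V - (m : ℤ) • U = (∑ x ∈ T, Y x - ∑ x ∈ T', Y x) - (∑ x ∈ T, Y x - (m : ℤ) • V) + (∑ x ∈ T', Y x - (m : ℤ) • U) := by
      abel
    rw [e]; exact Submodule.add_mem _ (Submodule.sub_mem _ hR h1) h3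
  -- `−m(V + U) = (Σ_A Y' − Σ_{A'} Y') − (Σ_A Y' + mV) + (Σ_{A'} Y' − mU)`
  have hVU' : -((m : ℤ) • V) - (m : ℤ) • U ∈ L := by
    have e : -((m : ℤ) • V) - (m : ℤ) • U = (∑ y ∈ A, Y' y - ∑ y ∈ A', Y' y) - (∑ y ∈ A, Y' y + (m : ℤ) • V) + (∑ y ∈ A', Y' y - (m : ℤ) • U) := by
      abel
    rw [e]; exact Submodule.add_mem _ (Submodule.sub_mem _ hRc h2) h4
  constructor
  · have e : (2 * (m : ℤ)) • U = -(((m : ℤ) • V - (m : ℤ) • U) + (-((m : ℤ) • V) - (m : ℤ) • U)) := by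
      rw [mul_smul, two_smul]; abel
    rw [e]; exact Submodule.neg_mem _ (Submodule.add_mem _ hVU hVU')
  · have e : (2 * (m : ℤ)) • V = ((m : ℤ) • V - (m : ℤ) • U) - (-((m : ℤ) • V) - (m : ℤ) • U) := by
      rw [mul_smul, two_smul]; abel
    rw [e]; exact Submodule.sub_mem _ hVU hVU'

/-- The individual classes: under the hypotheses of `two_mul_smul_mem_of_congruences`, `2m·Y_x ∈ L` for `x ∈ T ∪ T'` and `2m·Y'_y ∈ L` for `y ∈ A ∪ A'`.
[folklore] -/
theorem two_mul_smul_Y_mem_of_congruences {ι M : Type*} [DecidableEq ι] [AddCommGroup M] (L : Submodule ℤ M) (T T' A A' : Finset ι) (Y Y' : ι → M)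
    (U V : M) (m : ℕ) (hTm : T.card = m) (hT'm : T'.card = m) (hAm : A.card = m) (hA'm : A'.card = m)
    (hR : ∑ x ∈ T, Y x - ∑ x ∈ T', Y x ∈ L) (hRc : ∑ y ∈ A, Y' y - ∑ y ∈ A', Y' y ∈ L)
    (hVT : ∀ x ∈ T, Y x - V ∈ L) (hVA : ∀ y ∈ A, Y' y + V ∈ L) (hUT' : ∀ x ∈ T', Y x - U ∈ L) (hUA' : ∀ y ∈ A', Y' y - U ∈ L) :
    (∀ x ∈ T ∪ T', (2 * (m : ℤ)) • Y x ∈ L) ∧ (∀ y ∈ A ∪ A', (2 * (m : ℤ)) • Y' y ∈ L) := by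
  obtain ⟨hU, hV⟩ := two_mul_smul_mem_of_congruences L T T' A A' Y Y' U V m hTm hT'm hAm hA'm hR hRc hVT hVA hUT' hUA'
  constructor
  · intro x hx
    rcases mem_union.mp hx with hx | hx
    · have e : (2 * (m : ℤ)) • Y x = (2 * (m : ℤ)) • (Y x - V) + (2 * (m : ℤ)) • V := by rw [smul_sub, sub_add_cancel]
      rw [e]; exact Submodule.add_mem _ (Submodule.smul_mem _ _ (hVT x hx)) hV
    · have e : (2 * (m : ℤ)) • Y x = (2 * (m : ℤ)) • (Y x - U) + (2 * (m : ℤ)) • U := by rw [smul_sub, sub_add_cancel]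
      rw [e]; exact Submodule.add_mem _ (Submodule.smul_mem _ _ (hUT' x hx)) hU
  · intro y hy
    rcases mem_union.mp hy with hy | hy
    · have e : (2 * (m : ℤ)) • Y' y = (2 * (m : ℤ)) • (Y' y + V) - (2 * (m : ℤ)) • V := by rw [smul_add, add_sub_cancel_right]
      rw [e]; exact Submodule.sub_mem _ (Submodule.smul_mem _ _ (hVA y hy)) hV
    · have e : (2 * (m : ℤ)) • Y' y = (2 * (m : ℤ)) • (Y' y - U) + (2 * (m : ℤ)) • U := by rw [smul_sub, sub_add_cancel]
      rw [e]; exact Submodule.add_mem _ (Submodule.smul_mem _ _ (hUA' y hy)) hU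

/-! ## §3 The residual closure of the cyclic-kernel frame -/

/-- **RESIDUAL CLOSURE OF THE CYCLIC-KERNEL FRAME, UP TO `2m = 2ᵏ`.**  Frame `(T₀; T₁)` (`|𝓗| = |𝓗ᶜ| = 2m`), `T ⊆ 𝓗` and `A ⊆ 𝓗ᶜ` of size `m`,
`T' = 𝓗 ∖ T`, `A' = 𝓗ᶜ ∖ A`; `L ∋` all pairs, `R(T)`, `R(T')`, `Rᶜ(A)`, `Rᶜ(A')`; elements `u, v` with `Y_x − Y_v ∈ L` (`x ∈ T`), `Y'_y + Y_v ∈ L`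
(`y ∈ A`), `Y_x − Y_u ∈ L` (`x ∈ T'`), `Y'_y − Y_u ∈ L` (`y ∈ A'`).  Then `2ᵏ·y ∈ L` for every `y ∈ hodgeSpan` supported on residual types. [folklore] -/
theorem residual_closure_cyclic (hc2 : c * c = 1) (hc1 : c ≠ 1) (hcen : ∀ x : G, x * c = c * x) (T₀ T₁ : CMF G c)
    (L : Submodule ℤ (CMF G c →₀ ℤ)) (hP : ∀ Ψ : CMF G c, pair c Ψ ∈ L) (k m : ℕ) (hkm : (2 : ℤ) ^ k = 2 * (m : ℤ))
    (hH : (T₀.1 \ T₁.1).card = 2 * m) (hHc : (T₀.1 ∩ T₁.1).card = 2 * m)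
    (T : Finset G) (hTH : T ⊆ T₀.1 \ T₁.1) (hTm : T.card = m) (A : Finset G) (hA : A ⊆ T₀.1 ∩ T₁.1) (hAm : A.card = m)
    (hRT : ∑ s ∈ T, Finsupp.single (oflipCM c hc2 s T₀) (1 : ℤ) - ∑ u ∈ (T₀.1 \ T₁.1) \ T, Finsupp.single (oflipCM c hc2 u T₁) (1 : ℤ) -
        ((m : ℤ) - 1) • (Finsupp.single T₀ (1 : ℤ) - Finsupp.single T₁ 1) ∈ L)
    (hRT' : ∑ s ∈ (T₀.1 \ T₁.1) \ T, Finsupp.single (oflipCM c hc2 s T₀) (1 : ℤ) -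
        ∑ u ∈ (T₀.1 \ T₁.1) \ ((T₀.1 \ T₁.1) \ T), Finsupp.single (oflipCM c hc2 u T₁) (1 : ℤ) -
        ((m : ℤ) - 1) • (Finsupp.single T₀ (1 : ℤ) - Finsupp.single T₁ 1) ∈ L)
    (hRA : ∑ s ∈ A, Finsupp.single (oflipCM c hc2 s T₀) (1 : ℤ) + ∑ u ∈ (T₀.1 ∩ T₁.1) \ A, Finsupp.single (oflipCM c hc2 u T₁) (1 : ℤ) -
        ((m : ℤ) - 1) • (Finsupp.single T₀ (1 : ℤ) + Finsupp.single T₁ 1) ∈ L)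
    (hRA' : ∑ s ∈ (T₀.1 ∩ T₁.1) \ A, Finsupp.single (oflipCM c hc2 s T₀) (1 : ℤ) +
        ∑ u ∈ (T₀.1 ∩ T₁.1) \ ((T₀.1 ∩ T₁.1) \ A), Finsupp.single (oflipCM c hc2 u T₁) (1 : ℤ) -
        ((m : ℤ) - 1) • (Finsupp.single T₀ (1 : ℤ) + Finsupp.single T₁ 1) ∈ L)
    {u v : G}
    (hVT : ∀ x ∈ T, ((Finsupp.single (oflipCM c hc2 x T₀) (1 : ℤ) - Finsupp.single T₀ 1) +
        (Finsupp.single (oflipCM c hc2 x T₁) (1 : ℤ) - Finsupp.single T₁ 1)) -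
      ((Finsupp.single (oflipCM c hc2 v T₀) (1 : ℤ) - Finsupp.single T₀ 1) +
        (Finsupp.single (oflipCM c hc2 v T₁) (1 : ℤ) - Finsupp.single T₁ 1)) ∈ L)
    (hVA : ∀ y ∈ A, ((Finsupp.single (oflipCM c hc2 y T₀) (1 : ℤ) - Finsupp.single T₀ 1) -
        (Finsupp.single (oflipCM c hc2 y T₁) (1 : ℤ) - Finsupp.single T₁ 1)) +
      ((Finsupp.single (oflipCM c hc2 v T₀) (1 : ℤ) - Finsupp.single T₀ 1) +
        (Finsupp.single (oflipCM c hc2 v T₁) (1 : ℤ) - Finsupp.single T₁ 1)) ∈ L)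
    (hUT' : ∀ x ∈ (T₀.1 \ T₁.1) \ T, ((Finsupp.single (oflipCM c hc2 x T₀) (1 : ℤ) - Finsupp.single T₀ 1) +
        (Finsupp.single (oflipCM c hc2 x T₁) (1 : ℤ) - Finsupp.single T₁ 1)) -
      ((Finsupp.single (oflipCM c hc2 u T₀) (1 : ℤ) - Finsupp.single T₀ 1) +
        (Finsupp.single (oflipCM c hc2 u T₁) (1 : ℤ) - Finsupp.single T₁ 1)) ∈ L)
    (hUA' : ∀ y ∈ (T₀.1 ∩ T₁.1) \ A, ((Finsupp.single (oflipCM c hc2 y T₀) (1 : ℤ) - Finsupp.single T₀ 1) -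
        (Finsupp.single (oflipCM c hc2 y T₁) (1 : ℤ) - Finsupp.single T₁ 1)) -
      ((Finsupp.single (oflipCM c hc2 u T₀) (1 : ℤ) - Finsupp.single T₀ 1) +
        (Finsupp.single (oflipCM c hc2 u T₁) (1 : ℤ) - Finsupp.single T₁ 1)) ∈ L) :
    ∀ y ∈ hodgeSpan c hc2, (∀ Ψ ∈ y.support, Ψ = T₀ ∨ Ψ = T₁ ∨ Ψ = rt c c T₀ ∨ Ψ = rt c c T₁ ∨
      ∃ s : G, Ψ = oflipCM c hc2 s T₀ ∨ Ψ = oflipCM c hc2 s T₁ ∨ Ψ = oflipCM c hc2 s (rt c c T₀) ∨ Ψ = oflipCM c hc2 s (rt c c T₁)) →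
      ((2 : ℤ) ^ k) • y ∈ L := by
  have hT'm : ((T₀.1 \ T₁.1) \ T).card = m := by rw [card_sdiff_of_subset hTH, hH, hTm]; omega
  have hA'm : ((T₀.1 ∩ T₁.1) \ A).card = m := by rw [card_sdiff_of_subset hA, hHc, hAm]; omega
  have hR := Submodule.sub_mem _ hRT hRT'
  rw [rel_sub_rel_compl c hc2 T₀ T₁ m hH T hTH hTm] at hR
  have hRc := Submodule.sub_mem _ hRA hRA'
  rw [relc_sub_relc_compl c hc2 T₀ T₁ m hHc A hA hAm] at hRc
  obtain ⟨hY, hY'⟩ := two_mul_smul_Y_mem_of_congruences L T ((T₀.1 \ T₁.1) \ T) A ((T₀.1 ∩ T₁.1) \ A)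
    (fun s => (Finsupp.single (oflipCM c hc2 s T₀) (1 : ℤ) - Finsupp.single T₀ 1) + (Finsupp.single (oflipCM c hc2 s T₁) (1 : ℤ) - Finsupp.single T₁ 1))
    (fun s => (Finsupp.single (oflipCM c hc2 s T₀) (1 : ℤ) - Finsupp.single T₀ 1) - (Finsupp.single (oflipCM c hc2 s T₁) (1 : ℤ) - Finsupp.single T₁ 1))
    _ _ m hTm hT'm hAm hA'm hR hRc hVT hVA hUT' hUA'
  have hTU : T ∪ (T₀.1 \ T₁.1) \ T = T₀.1 \ T₁.1 := union_sdiff_of_subset hTH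
  have hAU : A ∪ (T₀.1 ∩ T₁.1) \ A = T₀.1 ∩ T₁.1 := union_sdiff_of_subset hA
  rw [hTU] at hY
  rw [hAU] at hY'
  refine residual_closure_four_pow c hc2 hc1 hcen T₀ T₁ L hP k m hH hHc (fun s hs => ?_) (fun s hs => ?_) ⟨T, hTH, hTm, hRT⟩ ⟨A, hA, hAm, hRA⟩
  · rw [hkm]; exact hY s hs
  · rw [hkm]; exact hY' s hs

end

end Summit.HodgeConjecture.CorCM.Census.CentralSquares
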